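import Literature.AlgebraicGeometry.Motives.SectionsOverLocalization
import Mathlib.RingTheory.Localization.Integer
import HarnessLib

/-!
# Kernels of matrices over basic opens and the localized isomorphism `Γ(π⁻¹B_a, 𝒪(D)) ≅ Ker(d|_{B_a})` (Görtz–Wedhorn II, Cor. 23.137 at the flat algebras `A_a`)

Second half of the localization step between the affine and the basic-open forms of the
Grothendieck complex of `𝒪(D)` in degree `0` (`Motives/SectionsOverLocalization` has the first
half: `Γ(π⁻¹B_a, 𝒪_W(D)) = Γ(π⁻¹V, 𝒪_W(D))_a`). In the printed source (Görtz–Wedhorn II,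
Cor. 23.137; Mumford, *Abelian Varieties*, §5) the isomorphisms
`Γ(pr_T⁻¹T_a, 𝒪(D)) ≅ Ker(d|_{T_a})` on the basic opens of `V = Spec A` come from ONE `A`-linear
isomorphism `Γ(pr_T⁻¹V, 𝒪(D)) = H⁰(K^•) ≅ Ker(d)` by the flat base change `A → A_a`, under which
`H⁰(K^• ⊗_A A_a) = H⁰(K^•) ⊗_A A_a`, i.e. `Ker(d ⊗ A_a) = Ker(d)_a` (localization is exact):

* `kerToKerBasicOpen`, `isLocalizedModule_kerToKerBasicOpen` — PROVED: for a matrix `d` over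
  `Γ(V, 𝒪_B)` (`V` affine, `Γ(V, 𝒪_B)` a domain, `a ≠ 0`), the restriction `Ker(d) → Ker(d|_{B_a})`
  is a localization away from `a` (`Γ(B_a, 𝒪_B) = Γ(V, 𝒪_B)_a`, Mathlib
  `IsAffineOpen.isLocalization_basicOpen`; common denominators by
  `IsLocalization.exist_integer_multiples_of_finite`, and `d w = 0` for the numerators because
  `Γ(V, 𝒪_B) → Γ(V, 𝒪_B)_a` is injective);
* `CartierDivisor.locEquiv` — the isomorphism `φ_a : Γ(π⁻¹B_a, 𝒪_W(D)) ≅ Ker(d|_{B_a})` induced by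
  an `A`-linear `φ_V : Γ(π⁻¹V, 𝒪_W(D)) ≅ Ker(d)` (Mathlib `IsLocalizedModule.linearEquiv` for the two
  localizations `CartierDivisor.isLocalizedModule_sectionsOverMod` and
  `isLocalizedModule_kerToKerBasicOpen`), with `locEquiv_inclusion` (`φ_a(s) = φ_V(s)|_{B_a}`),
  `exists_pow_smul_locEquiv` (clearing denominators under `φ_a`) and NATURALITY
  `kerRestrict_locEquiv` in `B_b ⊆ B_a` (uniqueness of extensions along a localization, Mathlib
  `IsLocalizedModule.ext`).

The application to `pr_T : X ×_K T → T` is `Motives/SeesawGrauertLocalization`. Mathlib searched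
(pin): `IsLocalizedModule.Away.mk`, `IsLocalizedModule.linearEquiv(_apply)`,
`IsLocalizedModule.ext`, `IsLocalizedModule.Away.surj`, `IsAffineOpen.isLocalization_basicOpen`,
`IsLocalization.exist_integer_multiples_of_finite`, `IsLocalization.injective`,
`Module.End.isUnit_iff`, `RingedSpace.isUnit_res_basicOpen` (all used); Mathlib's
`LinearMap.toKerLocalized_isLocalizedModule` (kernels commute with localization) is phrased for
the abstract localized map `IsLocalizedModule.map` and was not usable verbatim for the concrete
matrix `d.map (algebraMap _ _)` acting on `Γ(B_a, 𝒪_B)^m`.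

## References

* U. Görtz, T. Wedhorn, *Algebraic Geometry II: Cohomology of Schemes*, Springer Spektrum (2023),
  doi:10.1007/978-3-658-43031-3: Cor. 23.135, Cor. 23.137, p. 480 (read via the held copy).
  [GortzWedhorn2023]
* U. Görtz, T. Wedhorn, *Algebraic Geometry I: Schemes*, 2nd ed. (2020): Thm. 7.22, p. 188;
  (11.9), pp. 373–374. [GortzWedhorn2020]
* D. Mumford, *Abelian Varieties*, TIFR Studies in Mathematics 5 (1970): §5, Lemma 2 and the
  surrounding discussion (base change of the Grothendieck complex). [MumfordAV1970]
-/

universe u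

open CategoryTheory CategoryTheory.Limits AlgebraicGeometry TopologicalSpace Opposite Matrix
open Literature.AlgebraicGeometry.Motives.RatFn

noncomputable section

namespace Literature.AlgebraicGeometry.Motives

/-! ### `Ker(d|_{B_a}) = (Ker d)_a`: kernels of matrices commute with localization -/

section KerLocalization

variable {B : Scheme.{u}} {V : B.Opens} {m n : ℕ} (d : Matrix (Fin n) (Fin m) Γ(B, V)) (a : Γ(B, V))

/-- Scalars acting through a unit act invertibly: if `r ∈ R` maps to a unit of the `R`-algebra
`S` then `r` acts bijectively on every `S`-module. [folklore] -/
theorem isUnit_algebraMap_end_of_isUnit_algebraMap {R S N : Type*} [CommSemiring R]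
    [CommSemiring S] [Algebra R S] [AddCommMonoid N] [Module R N] [Module S N]
    [IsScalarTower R S N] {r : R} (h : IsUnit (algebraMap R S r)) :
    IsUnit (algebraMap R (Module.End R N) r) := by
  obtain ⟨u, hu⟩ := h
  have e : ∀ x : N, r • x = (u : S) • x := fun x => by rw [hu, algebraMap_smul]
  refine (Module.End.isUnit_iff _).2 ⟨fun x y hxy => ?_, fun x => ⟨(↑u⁻¹ : S) • x, ?_⟩⟩
  · rw [Module.algebraMap_end_apply, Module.algebraMap_end_apply, e, e] at hxy
    exact u.isUnit.smul_left_cancel.1 hxy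
  · rw [Module.algebraMap_end_apply, e, smul_smul, Units.mul_inv, one_smul]

/-- **The restriction `Ker(d) → Ker(d|_{B_a})`**, `v ↦ v|_{B_a}` componentwise
(`Γ(B_a, 𝒪_B)` is a `Γ(V, 𝒪_B)`-algebra by restriction, Mathlib
`algebra_section_section_basicOpen`). [folklore] -/
def kerToKerBasicOpen : LinearMap.ker d.mulVecLin →ₗ[Γ(B, V)]
    LinearMap.ker (d.map (algebraMap Γ(B, V) Γ(B, B.basicOpen a))).mulVecLin where
  toFun v := ⟨fun i => algebraMap Γ(B, V) Γ(B, B.basicOpen a) ((v : Fin m → Γ(B, V)) i), by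
    have hv := v.2
    rw [LinearMap.mem_ker, Matrix.mulVecLin_apply] at hv ⊢
    funext j
    have h := RingHom.map_mulVec (algebraMap Γ(B, V) Γ(B, B.basicOpen a)) d (v : Fin m → Γ(B, V)) j
    rw [hv, Pi.zero_apply, map_zero] at h
    exact h.symm⟩
  map_add' v w := by
    apply Subtype.ext
    funext i
    simp
  map_smul' c v := by
    apply Subtype.ext
    funext i
    simp [Algebra.smul_def]

/-- The components of `kerToKerBasicOpen d a v` are the restrictions of those of `v`. [folklore] -/
@[simp] theorem coe_kerToKerBasicOpen_apply (v : LinearMap.ker d.mulVecLin) (i : Fin m) :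
    (kerToKerBasicOpen d a v : Fin m → Γ(B, B.basicOpen a)) i =
      algebraMap Γ(B, V) Γ(B, B.basicOpen a) ((v : Fin m → Γ(B, V)) i) := rfl

/-- **`Ker(d|_{B_a})` is the localization of `Ker(d)` away from `a`** (localization is exact; here
for an affine open `V` of a scheme with `Γ(V, 𝒪_B)` a domain and `a ≠ 0`, where
`Γ(B_a, 𝒪_B) = Γ(V, 𝒪_B)_a`, Mathlib `IsAffineOpen.isLocalization_basicOpen`): `a` acts invertibly
on `Ker(d|_{B_a})`, every `v ∈ Ker(d|_{B_a})` has `a^N v = w|_{B_a}` with `w ∈ Γ(V, 𝒪_B)^m`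
(common denominator), where `d w = 0` because `Γ(V, 𝒪_B) → Γ(V, 𝒪_B)_a` is injective, and the
restriction is injective. [folklore] -/
theorem isLocalizedModule_kerToKerBasicOpen (hV : IsAffineOpen V) [IsDomain Γ(B, V)] (ha : a ≠ 0) :
    IsLocalizedModule.Away a (kerToKerBasicOpen d a) := by
  haveI : IsLocalization.Away a Γ(B, B.basicOpen a) := hV.isLocalization_basicOpen a
  have hinj : Function.Injective (algebraMap Γ(B, V) Γ(B, B.basicOpen a)) :=
    IsLocalization.injective _ (powers_le_nonZeroDivisors_of_noZeroDivisors ha)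
  refine IsLocalizedModule.Away.mk ?_ ?_ ?_
  · exact isUnit_algebraMap_end_of_isUnit_algebraMap (S := Γ(B, B.basicOpen a))
      (IsLocalization.Away.algebraMap_isUnit a)
  · intro v
    obtain ⟨⟨_, N, rfl⟩, hb⟩ := IsLocalization.exist_integer_multiples_of_finite
      (Submonoid.powers a) (fun i => (v : Fin m → Γ(B, B.basicOpen a)) i)
    choose w hw using hb
    have hφw : (fun i => algebraMap Γ(B, V) Γ(B, B.basicOpen a) (w i)) =
        a ^ N • (v : Fin m → Γ(B, B.basicOpen a)) := funext hw
    have hker : w ∈ LinearMap.ker d.mulVecLin := by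
      rw [LinearMap.mem_ker, Matrix.mulVecLin_apply]
      funext j
      apply hinj
      rw [RingHom.map_mulVec, Pi.zero_apply, map_zero]
      change ((d.map (algebraMap Γ(B, V) Γ(B, B.basicOpen a))) *ᵥ
        (fun i => algebraMap Γ(B, V) Γ(B, B.basicOpen a) (w i))) j = 0
      rw [hφw, Matrix.mulVec_smul]
      have hv := v.2
      rw [LinearMap.mem_ker, Matrix.mulVecLin_apply] at hv
      rw [hv, smul_zero, Pi.zero_apply]
    refine ⟨N, ⟨w, hker⟩, Subtype.ext ?_⟩
    exact hφw.symm
  · intro x y hxy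
    have h : x = y := by
      apply Subtype.ext
      funext i
      exact hinj (congr_fun (congr_arg Subtype.val hxy) i)
    subst h
    exact ⟨0, rfl⟩

end KerLocalization

namespace CartierDivisor

variable {W B : Scheme.{u}} [IsIntegral W] (π : W ⟶ B) (D : CartierDivisor W) {V : B.Opens}
  (hgen : genericPoint W ∈ π ⁻¹ᵁ V)

/-! ### The localized isomorphism `Γ(π⁻¹B_a, 𝒪(D)) ≅ Ker(d|_{B_a})` -/

section LocEquiv

variable {m n : ℕ} (d : Matrix (Fin n) (Fin m) Γ(B, V))

/-- Restriction to a smaller basic open commutes with the algebra maps: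
`(c|_{B_a})|_{B_b} = c|_{B_b}`. [folklore] -/
theorem map_homOfLE_algebraMap {a b : Γ(B, V)} (hab : B.basicOpen b ≤ B.basicOpen a) (c : Γ(B, V)) :
    B.presheaf.map (homOfLE hab).op (algebraMap Γ(B, V) Γ(B, B.basicOpen a) c) =
      algebraMap Γ(B, V) Γ(B, B.basicOpen b) c := by
  change (B.presheaf.map (homOfLE (B.basicOpen_le a)).op ≫ B.presheaf.map (homOfLE hab).op) c =
    B.presheaf.map (homOfLE (B.basicOpen_le b)).op c
  rw [← B.presheaf.map_comp]
  rfl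

/-- `a` is a unit on every basic open `B_b ⊆ B_a`. [folklore] -/
theorem isUnit_algebraMap_of_basicOpen_le {a b : Γ(B, V)} (hab : B.basicOpen b ≤ B.basicOpen a) :
    IsUnit (algebraMap Γ(B, V) Γ(B, B.basicOpen b) a) := by
  rw [← map_homOfLE_algebraMap hab]
  exact (B.toRingedSpace.isUnit_res_basicOpen a).map _

/-- **The restriction `Ker(d|_{B_a}) → Ker(d|_{B_b})`** for `B_b ⊆ B_a`, componentwise.
[folklore] -/
def kerRestrict {a b : Γ(B, V)} (hab : B.basicOpen b ≤ B.basicOpen a) :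
    LinearMap.ker (d.map (algebraMap Γ(B, V) Γ(B, B.basicOpen a))).mulVecLin →ₗ[Γ(B, V)]
      LinearMap.ker (d.map (algebraMap Γ(B, V) Γ(B, B.basicOpen b))).mulVecLin where
  toFun v := ⟨fun i => B.presheaf.map (homOfLE hab).op ((v : Fin m → Γ(B, B.basicOpen a)) i), by
    have hv := map_mem_matrixKerOver d (B.basicOpen_le a) hab
      (v := (v : Fin m → Γ(B, B.basicOpen a))) v.2
    exact hv⟩
  map_add' v w := by
    apply Subtype.ext
    funext i
    simp
  map_smul' c v := by
    apply Subtype.ext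
    funext i
    change B.presheaf.map (homOfLE hab).op (((c • v : LinearMap.ker (d.map (algebraMap Γ(B, V)
        Γ(B, B.basicOpen a))).mulVecLin) : Fin m → Γ(B, B.basicOpen a)) i) =
      (c • fun i => B.presheaf.map (homOfLE hab).op ((v : Fin m → Γ(B, B.basicOpen a)) i)) i
    rw [Submodule.coe_smul_of_tower, Pi.smul_apply, Pi.smul_apply, Algebra.smul_def,
      Algebra.smul_def, map_mul, map_homOfLE_algebraMap]

/-- The components of `kerRestrict d hab v` are the restrictions of those of `v`. [folklore] -/
@[simp] theorem coe_kerRestrict_apply {a b : Γ(B, V)} (hab : B.basicOpen b ≤ B.basicOpen a)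
    (v : LinearMap.ker (d.map (algebraMap Γ(B, V) Γ(B, B.basicOpen a))).mulVecLin) (i : Fin m) :
    (kerRestrict d hab v : Fin m → Γ(B, B.basicOpen b)) i =
      B.presheaf.map (homOfLE hab).op ((v : Fin m → Γ(B, B.basicOpen a)) i) := rfl

variable [QuasiCompact π] (hV : IsAffineOpen V) [IsDomain Γ(B, V)]
  (φV : letI := baseAlgebra π V hgen
    D.sectionsOverMod π hgen V le_rfl ≃ₗ[Γ(B, V)] LinearMap.ker d.mulVecLin)

/-- **The localized isomorphism.** Given a `Γ(V, 𝒪_B)`-linear isomorphism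
`φ_V : Γ(π⁻¹V, 𝒪_W(D)) ≅ Ker(d)` (`V` affine, `π` quasi-compact, `Γ(V, 𝒪_B)` a domain), the
isomorphism `Γ(π⁻¹B_a, 𝒪_W(D)) ≅ Ker(d|_{B_a})` of localizations away from `a` characterised by
`φ_a(s) = φ_V(s)|_{B_a}` for `s ∈ Γ(π⁻¹V, 𝒪_W(D))` (Mathlib `IsLocalizedModule.linearEquiv`; both
sides are localizations of isomorphic modules, `isLocalizedModule_sectionsOverMod`,
`isLocalizedModule_kerToKerBasicOpen`) — the base change `H⁰(K^• ⊗_A A_a) = H⁰(K^•) ⊗_A A_a` of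
the Grothendieck complex to the flat `A`-algebra `A_a`. [folklore] -/
def locEquiv (a : Γ(B, V)) (ha : genericPoint W ∈ π ⁻¹ᵁ B.basicOpen a) (ha0 : a ≠ 0) :
    letI := baseAlgebra π V hgen
    D.sectionsOverMod π hgen (B.basicOpen a) (B.basicOpen_le a) ≃ₗ[Γ(B, V)]
      LinearMap.ker (d.map (algebraMap Γ(B, V) Γ(B, B.basicOpen a))).mulVecLin :=
  letI := baseAlgebra π V hgen
  haveI := isLocalizedModule_sectionsOverMod π D hgen hV a ha
  haveI := isLocalizedModule_kerToKerBasicOpen d a hV ha0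
  IsLocalizedModule.linearEquiv (Submonoid.powers a)
    (Submodule.inclusion (sectionsOverMod_mono hgen (le_refl V) (B.basicOpen_le a)))
    (kerToKerBasicOpen d a ∘ₗ (φV : D.sectionsOverMod π hgen V le_rfl →ₗ[Γ(B, V)]
      LinearMap.ker d.mulVecLin))

/-- The characterising property `φ_a(s) = φ_V(s)|_{B_a}` of `locEquiv`. [folklore] -/
theorem locEquiv_inclusion (a : Γ(B, V)) (ha : genericPoint W ∈ π ⁻¹ᵁ B.basicOpen a) (ha0 : a ≠ 0) :
    letI := baseAlgebra π V hgen
    ∀ s : D.sectionsOverMod π hgen V le_rfl,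
      locEquiv π D hgen d hV φV a ha ha0
        (Submodule.inclusion (sectionsOverMod_mono hgen (le_refl V) (B.basicOpen_le a)) s) =
        kerToKerBasicOpen d a (φV s) := by
  intro s
  letI := baseAlgebra π V hgen
  haveI := isLocalizedModule_sectionsOverMod π D hgen hV a ha
  haveI := isLocalizedModule_kerToKerBasicOpen d a hV ha0
  exact IsLocalizedModule.linearEquiv_apply (Submonoid.powers a)
    (Submodule.inclusion (sectionsOverMod_mono hgen (le_refl V) (B.basicOpen_le a)))
    (kerToKerBasicOpen d a ∘ₗ (φV : D.sectionsOverMod π hgen V le_rfl →ₗ[Γ(B, V)]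
      LinearMap.ker d.mulVecLin)) s

/-- **Clearing denominators under `φ_a`**: every `s ∈ Γ(π⁻¹B_a, 𝒪_W(D))` has
`aᴺ s = s' ∈ Γ(π⁻¹V, 𝒪_W(D))` for some `N`, and then `aᴺ φ_a(s) = φ_V(s')|_{B_a}`. [folklore] -/
theorem exists_pow_smul_locEquiv (a : Γ(B, V)) (ha : genericPoint W ∈ π ⁻¹ᵁ B.basicOpen a)
    (ha0 : a ≠ 0)
    (s : letI := baseAlgebra π V hgen; D.sectionsOverMod π hgen (B.basicOpen a) (B.basicOpen_le a)) :
    letI := baseAlgebra π V hgen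
    ∃ (N : ℕ) (s' : D.sectionsOverMod π hgen V le_rfl),
      ofSection hgen (π.app V a) ^ N * (s : W.functionField) = s' ∧
      a ^ N • locEquiv π D hgen d hV φV a ha ha0 s = kerToKerBasicOpen d a (φV s') := by
  letI := baseAlgebra π V hgen
  haveI := isLocalizedModule_sectionsOverMod π D hgen hV a ha
  obtain ⟨N, s', hs'⟩ := IsLocalizedModule.Away.surj
    (Submodule.inclusion (sectionsOverMod_mono hgen (le_refl V) (B.basicOpen_le a))) a s
  refine ⟨N, s', ?_, ?_⟩
  · have h := congr_arg Subtype.val hs'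
    rw [Submodule.coe_smul, Algebra.smul_def, map_pow] at h
    exact h
  · rw [← map_smul, hs']
    exact locEquiv_inclusion π D hgen d hV φV a ha ha0 s'

/-- **Naturality of the localized isomorphisms** in `B_b ⊆ B_a`:
`φ_b(s)` is the restriction of `φ_a(s)` for `s ∈ Γ(π⁻¹B_a, 𝒪_W(D))` (both are the unique
extensions of `φ_V` along the localization `Γ(π⁻¹V, 𝒪(D)) → Γ(π⁻¹B_a, 𝒪(D))`, Mathlib
`IsLocalizedModule.ext`). [folklore] -/
theorem kerRestrict_locEquiv {a b : Γ(B, V)} (hab : B.basicOpen b ≤ B.basicOpen a)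
    (ha : genericPoint W ∈ π ⁻¹ᵁ B.basicOpen a) (ha0 : a ≠ 0)
    (hb : genericPoint W ∈ π ⁻¹ᵁ B.basicOpen b) (hb0 : b ≠ 0) :
    letI := baseAlgebra π V hgen
    ∀ s : D.sectionsOverMod π hgen (B.basicOpen a) (B.basicOpen_le a),
      kerRestrict d hab (locEquiv π D hgen d hV φV a ha ha0 s) =
        locEquiv π D hgen d hV φV b hb hb0 (Submodule.inclusion
          (sectionsOverMod_mono hgen (B.basicOpen_le a) hab) s) := by
  intro s
  letI := baseAlgebra π V hgen
  haveI := isLocalizedModule_sectionsOverMod π D hgen hV a ha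
  -- two linear maps out of the localization `Γ(π⁻¹B_a, 𝒪(D))` agreeing on `Γ(π⁻¹V, 𝒪(D))`
  have key : kerRestrict d hab ∘ₗ (locEquiv π D hgen d hV φV a ha ha0 :
      D.sectionsOverMod π hgen (B.basicOpen a) (B.basicOpen_le a) →ₗ[Γ(B, V)] _) =
      (locEquiv π D hgen d hV φV b hb hb0 : D.sectionsOverMod π hgen (B.basicOpen b)
        (B.basicOpen_le b) →ₗ[Γ(B, V)] _) ∘ₗ
        Submodule.inclusion (sectionsOverMod_mono hgen (B.basicOpen_le a) hab) := by
    apply IsLocalizedModule.ext (S := Submonoid.powers a)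
      (f := Submodule.inclusion (sectionsOverMod_mono hgen (le_refl V) (B.basicOpen_le a)))
    · rintro ⟨_, k, rfl⟩
      rw [map_pow]
      exact (isUnit_algebraMap_end_of_isUnit_algebraMap (S := Γ(B, B.basicOpen b))
        (isUnit_algebraMap_of_basicOpen_le hab)).pow k
    · apply LinearMap.ext
      intro x
      change kerRestrict d hab (locEquiv π D hgen d hV φV a ha ha0 (Submodule.inclusion _ x)) =
        locEquiv π D hgen d hV φV b hb hb0 (Submodule.inclusion _ (Submodule.inclusion _ x))
      rw [locEquiv_inclusion π D hgen d hV φV a ha ha0 x]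
      have e : Submodule.inclusion (sectionsOverMod_mono hgen (B.basicOpen_le a) hab)
          (Submodule.inclusion (sectionsOverMod_mono hgen (le_refl V) (B.basicOpen_le a)) x) =
          Submodule.inclusion (sectionsOverMod_mono hgen (le_refl V) (B.basicOpen_le b)) x := rfl
      rw [e, locEquiv_inclusion π D hgen d hV φV b hb hb0 x]
      apply Subtype.ext
      funext i
      simp only [coe_kerRestrict_apply, coe_kerToKerBasicOpen_apply, map_homOfLE_algebraMap]
  exact LinearMap.congr_fun key s

end LocEquiv

end CartierDivisor

end Literature.AlgebraicGeometry.Motives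

end
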